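import Literature.NumberTheory.LFunctions.AriasDeReynaLinePolynomial
import Mathlib.Analysis.SpecialFunctions.ImproperIntegrals
import Mathlib.MeasureTheory.Measure.Lebesgue.Integral
import HarnessLib

/-!
# The three numerical constants of Arias de Reyna's line `L` (proof of Thm. 4.2) and Thm. 4.2 itself

Topic `Literature/NumberTheory/LFunctions` (namespace `Literature.NumberTheory.LFunctions.AriasDeReyna`).
Completes the proof of Arias de Reyna's Thm. 4.2 (`AriasDeReynaRemainderBound.lean`) by establishing the three
numerical inputs about the weight `W(y) = |ζ(y)|²(1 + V(ζ(y)))` on the line `L`: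

* `wL_ge_min` — `W ≥ 0.1316` everywhere (source: `max 1/W = 7.489341`, i.e. `min W = 0.133523`; what Thm. 4.2
  needs is `max 1/W < 2π·1.21`);
* `integral_inv_wL_le` — `∫_ℝ dy/W ≤ 15` (source: `∫_L |dζ|/W = 9.577048`, i.e. `13.544` in the parameter `y`;
  certified here: `14.523`);
* `normSq_one_sub_lineL_le` — `|1 − ζ|² ≤ 6.15 W` (source: `max |1−ζ|²/W = 5.78453`);

by covering `[−10, 10]` with `40` pieces carrying certified linear minorants of `W` (`PieceOK`: `12` polynomial
pieces on `[−5/4, 3/10]` from `AriasDeReynaLinePolynomial.lean`, `28` closed-form pieces from the monotone-factor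
bounds of `AriasDeReynaLineClosedForm.lean`) and the tails `W ≥ y²/4` (`y ≤ −10`), `W ≥ y²/4.5` (`y ≥ 10`).
The final statements `norm_remainder_le` (Thm. 4.2) and `norm_rsLineIntegral_sub_expansion_le` (Thm. 3.1 with
the bound of Thm. 4.2, non-integer `a`) are then unconditional. Everything is proved; no named facts.

## References

* J. Arias de Reyna, *High precision computation of Riemann's zeta function by the Riemann–Siegel
  formula, I*, Math. Comp. 80 (2011), 995–1009: Thm. 4.2, eqs. (4.7)–(4.9) and the constants on p. 1002–1003.
  [AriasDeReyna2011]
-/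

noncomputable section

open Complex MeasureTheory Set Filter Real
open scoped Topology
open Literature.NumberTheory.LFunctions.SiegelIntegral Literature.NumberTheory.LFunctions.Gabcke

namespace Literature.NumberTheory.LFunctions

namespace AriasDeReyna

/-! ## The pieces of `[−10, −5/4]` (region `y ≤ −1`) -/

/-- Piece `[-10, -8]`. [cite: AriasDeReyna2011, proof of Thm. 4.2] -/
theorem pieceA_0 : PieceOK (-10 : ℝ) (-8 : ℝ) ((181738095237230626867253857 : ℝ) / 7117233066867924000000000) ((-17 : ℝ) / 4) := by
  refine ⟨by norm_num, ?_, by norm_num, by norm_num, by norm_num [eL], by norm_num [eL]⟩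
  intro y hy
  have h := wL_ge_regionA (p := (-10 : ℝ)) (q := (-8 : ℝ)) hy.1 hy.2 (by norm_num) 5 (by norm_num [eL])
  norm_num [tOne, gL, kL, dL, eL, logLB] at h ⊢
  linarith

/-- Piece `[-8, -6]`. [cite: AriasDeReyna2011, proof of Thm. 4.2] -/
theorem pieceA_1 : PieceOK (-8 : ℝ) (-6 : ℝ) ((354678647611128938839909 : ℝ) / 22072412096613000000000) ((-13 : ℝ) / 4) := by
  refine ⟨by norm_num, ?_, by norm_num, by norm_num, by norm_num [eL], by norm_num [eL]⟩
  intro y hy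
  have h := wL_ge_regionA (p := (-8 : ℝ)) (q := (-6 : ℝ)) hy.1 hy.2 (by norm_num) 4 (by norm_num [eL])
  norm_num [tOne, gL, kL, dL, eL, logLB] at h ⊢
  linarith

/-- Piece `[-6, -5]`. [cite: AriasDeReyna2011, proof of Thm. 4.2] -/
theorem pieceA_2 : PieceOK (-6 : ℝ) (-5 : ℝ) ((464750884885551936657203 : ℝ) / 49478910842340000000000) ((-11 : ℝ) / 4) := by
  refine ⟨by norm_num, ?_, by norm_num, by norm_num, by norm_num [eL], by norm_num [eL]⟩
  intro y hy
  have h := wL_ge_regionA (p := (-6 : ℝ)) (q := (-5 : ℝ)) hy.1 hy.2 (by norm_num) 3 (by norm_num [eL])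
  norm_num [tOne, gL, kL, dL, eL, logLB] at h ⊢
  linarith

/-- Piece `[-5, -4]`. [cite: AriasDeReyna2011, proof of Thm. 4.2] -/
theorem pieceA_3 : PieceOK (-5 : ℝ) (-4 : ℝ) ((498208163311369378211 : ℝ) / 77515527420000000000) ((-9 : ℝ) / 4) := by
  refine ⟨by norm_num, ?_, by norm_num, by norm_num, by norm_num [eL], by norm_num [eL]⟩
  intro y hy
  have h := wL_ge_regionA (p := (-5 : ℝ)) (q := (-4 : ℝ)) hy.1 hy.2 (by norm_num) 3 (by norm_num [eL])
  norm_num [tOne, gL, kL, dL, eL, logLB] at h ⊢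
  linarith

/-- Piece `[-4, -3]`. [cite: AriasDeReyna2011, proof of Thm. 4.2] -/
theorem pieceA_4 : PieceOK (-4 : ℝ) (-3 : ℝ) ((68308590089501941 : ℝ) / 17230250000000000) ((-7 : ℝ) / 4) := by
  refine ⟨by norm_num, ?_, by norm_num, by norm_num, by norm_num [eL], by norm_num [eL]⟩
  intro y hy
  have h := wL_ge_regionA (p := (-4 : ℝ)) (q := (-3 : ℝ)) hy.1 hy.2 (by norm_num) 2 (by norm_num [eL])
  norm_num [tOne, gL, kL, dL, eL, logLB] at h ⊢
  linarith

/-- Piece `[-3, -5/2]`. [cite: AriasDeReyna2011, proof of Thm. 4.2] -/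
theorem pieceA_5 : PieceOK (-3 : ℝ) ((-5 : ℝ) / 2) ((57671379763157681 : ℝ) / 25623702000000000) ((-3 : ℝ) / 2) := by
  refine ⟨by norm_num, ?_, by norm_num, by norm_num, by norm_num [eL], by norm_num [eL]⟩
  intro y hy
  have h := wL_ge_regionA (p := (-3 : ℝ)) (q := ((-5 : ℝ) / 2)) hy.1 hy.2 (by norm_num) 2 (by norm_num [eL])
  norm_num [tOne, gL, kL, dL, eL, logLB] at h ⊢
  linarith

/-- Piece `[-5/2, -9/4]`. [cite: AriasDeReyna2011, proof of Thm. 4.2] -/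
theorem pieceA_6 : PieceOK ((-5 : ℝ) / 2) ((-9 : ℝ) / 4) ((65851135432704109529 : ℝ) / 42178553077500000000) ((-11 : ℝ) / 8) := by
  refine ⟨by norm_num, ?_, by norm_num, by norm_num, by norm_num [eL], by norm_num [eL]⟩
  intro y hy
  have h := wL_ge_regionA (p := ((-5 : ℝ) / 2)) (q := ((-9 : ℝ) / 4)) hy.1 hy.2 (by norm_num) 1 (by norm_num [eL])
  norm_num [tOne, gL, kL, dL, eL, logLB] at h ⊢
  linarith

/-- Piece `[-9/4, -2]`. [cite: AriasDeReyna2011, proof of Thm. 4.2] -/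
theorem pieceA_7 : PieceOK ((-9 : ℝ) / 4) (-2 : ℝ) ((479502132886070484457 : ℝ) / 390520408005000000000) ((-5 : ℝ) / 4) := by
  refine ⟨by norm_num, ?_, by norm_num, by norm_num, by norm_num [eL], by norm_num [eL]⟩
  intro y hy
  have h := wL_ge_regionA (p := ((-9 : ℝ) / 4)) (q := (-2 : ℝ)) hy.1 hy.2 (by norm_num) 1 (by norm_num [eL])
  norm_num [tOne, gL, kL, dL, eL, logLB] at h ⊢
  linarith

/-- Piece `[-2, -7/4]`. [cite: AriasDeReyna2011, proof of Thm. 4.2] -/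
theorem pieceA_8 : PieceOK (-2 : ℝ) ((-7 : ℝ) / 4) ((74519361048404532263 : ℝ) / 80383160700000000000) ((-9 : ℝ) / 8) := by
  refine ⟨by norm_num, ?_, by norm_num, by norm_num, by norm_num [eL], by norm_num [eL]⟩
  intro y hy
  have h := wL_ge_regionA (p := (-2 : ℝ)) (q := ((-7 : ℝ) / 4)) hy.1 hy.2 (by norm_num) 1 (by norm_num [eL])
  norm_num [tOne, gL, kL, dL, eL, logLB] at h ⊢
  linarith

/-- Piece `[-7/4, -13/8]`. [cite: AriasDeReyna2011, proof of Thm. 4.2] -/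
theorem pieceA_9 : PieceOK ((-7 : ℝ) / 4) ((-13 : ℝ) / 8) ((1319442512206083362459 : ℝ) / 1858631129487000000000) ((-17 : ℝ) / 16) := by
  refine ⟨by norm_num, ?_, by norm_num, by norm_num, by norm_num [eL], by norm_num [eL]⟩
  intro y hy
  have h := wL_ge_regionA (p := ((-7 : ℝ) / 4)) (q := ((-13 : ℝ) / 8)) hy.1 hy.2 (by norm_num) 1 (by norm_num [eL])
  norm_num [tOne, gL, kL, dL, eL, logLB] at h ⊢
  linarith

/-- Piece `[-13/8, -3/2]`. [cite: AriasDeReyna2011, proof of Thm. 4.2] -/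
theorem pieceA_10 : PieceOK ((-13 : ℝ) / 8) ((-3 : ℝ) / 2) ((782005261976666299837 : ℝ) / 1318215069517500000000) (-1 : ℝ) := by
  refine ⟨by norm_num, ?_, by norm_num, by norm_num, by norm_num [eL], by norm_num [eL]⟩
  intro y hy
  have h := wL_ge_regionA (p := ((-13 : ℝ) / 8)) (q := ((-3 : ℝ) / 2)) hy.1 hy.2 (by norm_num) 1 (by norm_num [eL])
  norm_num [tOne, gL, kL, dL, eL, logLB] at h ⊢
  linarith

/-- Piece `[-3/2, -11/8]`. [cite: AriasDeReyna2011, proof of Thm. 4.2] -/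
theorem pieceA_11 : PieceOK ((-3 : ℝ) / 2) ((-11 : ℝ) / 8) ((1462406274609977 : ℝ) / 3014604540000000) ((-15 : ℝ) / 16) := by
  refine ⟨by norm_num, ?_, by norm_num, by norm_num, by norm_num [eL], by norm_num [eL]⟩
  intro y hy
  have h := wL_ge_regionA (p := ((-3 : ℝ) / 2)) (q := ((-11 : ℝ) / 8)) hy.1 hy.2 (by norm_num) 0 (by norm_num [eL])
  norm_num [tOne, gL, kL, dL, eL, logLB] at h ⊢
  linarith

/-- Piece `[-11/8, -5/4]`. [cite: AriasDeReyna2011, proof of Thm. 4.2] -/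
theorem pieceA_12 : PieceOK ((-11 : ℝ) / 8) ((-5 : ℝ) / 4) ((612008181152673 : ℝ) / 1581459670310000) ((-7 : ℝ) / 8) := by
  refine ⟨by norm_num, ?_, by norm_num, by norm_num, by norm_num [eL], by norm_num [eL]⟩
  intro y hy
  have h := wL_ge_regionA (p := ((-11 : ℝ) / 8)) (q := ((-5 : ℝ) / 4)) hy.1 hy.2 (by norm_num) 0 (by norm_num [eL])
  norm_num [tOne, gL, kL, dL, eL, logLB] at h ⊢
  linarith

/-! ## The pieces of `[3/10, 1/2]` (region `0 ≤ y ≤ 1/2`) -/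

/-- Piece `[3/10, 7/20]`. [cite: AriasDeReyna2011, proof of Thm. 4.2] -/
theorem pieceB1_0 : PieceOK ((3 : ℝ) / 10) ((7 : ℝ) / 20) ((29172617247232519792159921 : ℝ) / 49201144613197209500000000) ((-3 : ℝ) / 40) := by
  refine ⟨by norm_num, ?_, by norm_num, by norm_num, by norm_num [eL], by norm_num [eL]⟩
  intro y hy
  have h := wL_ge_regionB1 (p := ((3 : ℝ) / 10)) (q := ((7 : ℝ) / 20)) (by norm_num) hy.1 hy.2 (by norm_num) (by norm_num)
  norm_num [tOne, gL, kL, dL, eL, logLB] at h ⊢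
  linarith

/-- Piece `[7/20, 9/20]`. [cite: AriasDeReyna2011, proof of Thm. 4.2] -/
theorem pieceB1_1 : PieceOK ((7 : ℝ) / 20) ((9 : ℝ) / 20) ((312028101806921754189634697867 : ℝ) / 497990078310265773745500000000) ((-1 : ℝ) / 40) := by
  refine ⟨by norm_num, ?_, by norm_num, by norm_num, by norm_num [eL], by norm_num [eL]⟩
  intro y hy
  have h := wL_ge_regionB1 (p := ((7 : ℝ) / 20)) (q := ((9 : ℝ) / 20)) (by norm_num) hy.1 hy.2 (by norm_num) (by norm_num)
  norm_num [tOne, gL, kL, dL, eL, logLB] at h ⊢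
  linarith

/-- Piece `[9/20, 1/2]`. [cite: AriasDeReyna2011, proof of Thm. 4.2] -/
theorem pieceB1_2 : PieceOK ((9 : ℝ) / 20) ((1 : ℝ) / 2) ((2361561897021514790841646993 : ℝ) / 3062380997777546637500000000) (0 : ℝ) := by
  refine ⟨by norm_num, ?_, by norm_num, by norm_num, by norm_num [eL], by norm_num [eL]⟩
  intro y hy
  have h := wL_ge_regionB1 (p := ((9 : ℝ) / 20)) (q := ((1 : ℝ) / 2)) (by norm_num) hy.1 hy.2 (by norm_num) (by norm_num)
  norm_num [tOne, gL, kL, dL, eL, logLB] at h ⊢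
  linarith

/-! ## The pieces of `[1/2, 10]` (region `y ≥ 1/2`) -/

/-- Piece `[1/2, 5/8]`. [cite: AriasDeReyna2011, proof of Thm. 4.2] -/
theorem pieceB2_0 : PieceOK ((1 : ℝ) / 2) ((5 : ℝ) / 8) ((11163208535205823 : ℝ) / 14264941250000000) (0 : ℝ) := by
  refine ⟨by norm_num, ?_, by norm_num, by norm_num, by norm_num [eL], by norm_num [eL]⟩
  intro y hy
  have h := wL_ge_regionB2a (p := ((1 : ℝ) / 2)) (q := ((5 : ℝ) / 8)) (cθ := ((392699 : ℝ) / 500000)) (by norm_num) hy.1 hy.2 (by norm_num)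
    (fun y hpy ↦ by have := neg_thetaL_ge_half hpy; norm_num at this ⊢; linarith) 2 (by norm_num [eL])
  norm_num [tOne, gL, kL, dL, eL, logLB] at h ⊢
  linarith

/-- Piece `[5/8, 3/4]`. [cite: AriasDeReyna2011, proof of Thm. 4.2] -/
theorem pieceB2_1 : PieceOK ((5 : ℝ) / 8) ((3 : ℝ) / 4) ((691231333564663 : ℝ) / 772520125000000) ((1 : ℝ) / 16) := by
  refine ⟨by norm_num, ?_, by norm_num, by norm_num, by norm_num [eL], by norm_num [eL]⟩
  intro y hy
  have h := wL_ge_regionB2a (p := ((5 : ℝ) / 8)) (q := ((3 : ℝ) / 4)) (cθ := ((256811 : ℝ) / 250000)) (by norm_num) hy.1 hy.2 (by norm_num)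
    (fun y hpy ↦ by have := neg_thetaL_ge_of_lt_one (p := ((5 : ℝ) / 8)) (by norm_num) (by norm_num) hpy; norm_num at this ⊢; linarith) 2 (by norm_num [eL])
  norm_num [tOne, gL, kL, dL, eL, logLB] at h ⊢
  linarith

/-- Piece `[3/4, 7/8]`. [cite: AriasDeReyna2011, proof of Thm. 4.2] -/
theorem pieceB2_2 : PieceOK ((3 : ℝ) / 4) ((7 : ℝ) / 8) ((2778667244735799653 : ℝ) / 2759144208750000000) ((1 : ℝ) / 8) := by
  refine ⟨by norm_num, ?_, by norm_num, by norm_num, by norm_num [eL], by norm_num [eL]⟩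
  intro y hy
  have h := wL_ge_regionB2a (p := ((3 : ℝ) / 4)) (q := ((7 : ℝ) / 8)) (cθ := ((75875857 : ℝ) / 60750000)) (by norm_num) hy.1 hy.2 (by norm_num)
    (fun y hpy ↦ by have := neg_thetaL_ge_of_lt_one (p := ((3 : ℝ) / 4)) (by norm_num) (by norm_num) hpy; norm_num at this ⊢; linarith) 2 (by norm_num [eL])
  norm_num [tOne, gL, kL, dL, eL, logLB] at h ⊢
  linarith

/-- Piece `[7/8, 1]`. [cite: AriasDeReyna2011, proof of Thm. 4.2] -/
theorem pieceB2_3 : PieceOK ((7 : ℝ) / 8) (1 : ℝ) ((18234391595702733 : ℝ) / 16446850000000000) ((3 : ℝ) / 16) := by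
  refine ⟨by norm_num, ?_, by norm_num, by norm_num, by norm_num [eL], by norm_num [eL]⟩
  intro y hy
  have h := wL_ge_regionB2a (p := ((7 : ℝ) / 8)) (q := (1 : ℝ)) (cθ := ((18011626279 : ℝ) / 12605250000)) (by norm_num) hy.1 hy.2 (by norm_num)
    (fun y hpy ↦ by have := neg_thetaL_ge_of_lt_one (p := ((7 : ℝ) / 8)) (by norm_num) (by norm_num) hpy; norm_num at this ⊢; linarith) 2 (by norm_num [eL])
  norm_num [tOne, gL, kL, dL, eL, logLB] at h ⊢
  linarith

/-- Piece `[1, 5/4]`. [cite: AriasDeReyna2011, proof of Thm. 4.2] -/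
theorem pieceB2_4 : PieceOK (1 : ℝ) ((5 : ℝ) / 4) ((7235935238151569 : ℝ) / 6463085000000000) ((1 : ℝ) / 4) := by
  refine ⟨by norm_num, ?_, by norm_num, by norm_num, by norm_num [eL], by norm_num [eL]⟩
  intro y hy
  have h := wL_ge_regionB2a (p := (1 : ℝ)) (q := ((5 : ℝ) / 4)) (cθ := ((392699 : ℝ) / 250000)) (by norm_num) hy.1 hy.2 (by norm_num)
    (fun y hpy ↦ by have := neg_thetaL_ge_of_lt_one (p := (1 : ℝ)) (by norm_num) (by norm_num) hpy; norm_num at this ⊢; linarith) 1 (by norm_num [eL])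
  norm_num [tOne, gL, kL, dL, eL, logLB] at h ⊢
  linarith

/-- Piece `[5/4, 3/2]`. [cite: AriasDeReyna2011, proof of Thm. 4.2] -/
theorem pieceB2_5 : PieceOK ((5 : ℝ) / 4) ((3 : ℝ) / 2) ((18220503917951 : ℝ) / 13856479000000) ((3 : ℝ) / 8) := by
  refine ⟨by norm_num, ?_, by norm_num, by norm_num, by norm_num [eL], by norm_num [eL]⟩
  intro y hy
  have h := wL_ge_regionB2a (p := ((5 : ℝ) / 4)) (q := ((3 : ℝ) / 2)) (cθ := ((46415027 : ℝ) / 26250000)) (by norm_num) hy.1 hy.2 (by norm_num)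
    (fun y hpy ↦ by have := neg_thetaL_ge_of_one_le (p := ((5 : ℝ) / 4)) (by norm_num) hpy; norm_num at this ⊢; linarith) 0 (by norm_num [eL])
  norm_num [tOne, gL, kL, dL, eL, logLB] at h ⊢
  linarith

/-- Piece `[3/2, 2]`. [cite: AriasDeReyna2011, proof of Thm. 4.2] -/
theorem pieceB2_6 : PieceOK ((3 : ℝ) / 2) (2 : ℝ) ((3087394183 : ℝ) / 2168775000) ((1 : ℝ) / 2) := by
  refine ⟨by norm_num, ?_, by norm_num, by norm_num, by norm_num [eL], by norm_num [eL]⟩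
  intro y hy
  have h := wL_ge_regionB2b (p := ((3 : ℝ) / 2)) (q := (2 : ℝ)) (cθ := ((7243228991 : ℝ) / 3827250000)) (by norm_num) hy.1 hy.2 (by norm_num)
    (fun y hpy ↦ by have := neg_thetaL_ge_of_one_le (p := ((3 : ℝ) / 2)) (by norm_num) hpy; norm_num at this ⊢; linarith) 0 (by norm_num [eL])
  norm_num [tOne, gL, kL, dL, eL, logLB] at h ⊢
  linarith

/-- Piece `[2, 3]`. [cite: AriasDeReyna2011, proof of Thm. 4.2] -/
theorem pieceB2_7 : PieceOK (2 : ℝ) (3 : ℝ) ((4974548073 : ℝ) / 2843750000) ((3 : ℝ) / 4) := by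
  refine ⟨by norm_num, ?_, by norm_num, by norm_num, by norm_num [eL], by norm_num [eL]⟩
  intro y hy
  have h := wL_ge_regionB2b (p := (2 : ℝ)) (q := (3 : ℝ)) (cθ := ((85439057 : ℝ) / 42000000)) (by norm_num) hy.1 hy.2 (by norm_num)
    (fun y hpy ↦ by have := neg_thetaL_ge_of_one_le (p := (2 : ℝ)) (by norm_num) hpy; norm_num at this ⊢; linarith) 1 (by norm_num [eL])
  norm_num [tOne, gL, kL, dL, eL, logLB] at h ⊢
  linarith

/-- Piece `[3, 5]`. [cite: AriasDeReyna2011, proof of Thm. 4.2] -/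
theorem pieceB2_8 : PieceOK (3 : ℝ) (5 : ℝ) ((228431794636853 : ℝ) / 79734375000000) ((5 : ℝ) / 4) := by
  refine ⟨by norm_num, ?_, by norm_num, by norm_num, by norm_num [eL], by norm_num [eL]⟩
  intro y hy
  have h := wL_ge_regionB2b (p := (3 : ℝ)) (q := (5 : ℝ)) (cθ := ((8254128991 : ℝ) / 3827250000)) (by norm_num) hy.1 hy.2 (by norm_num)
    (fun y hpy ↦ by have := neg_thetaL_ge_of_one_le (p := (3 : ℝ)) (by norm_num) hpy; norm_num at this ⊢; linarith) 3 (by norm_num [eL])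
  norm_num [tOne, gL, kL, dL, eL, logLB] at h ⊢
  linarith

/-- Piece `[5, 7]`. [cite: AriasDeReyna2011, proof of Thm. 4.2] -/
theorem pieceB2_9 : PieceOK (5 : ℝ) (7 : ℝ) ((3493117562071 : ℝ) / 533750000000) ((9 : ℝ) / 4) := by
  refine ⟨by norm_num, ?_, by norm_num, by norm_num, by norm_num [eL], by norm_num [eL]⟩
  intro y hy
  have h := wL_ge_regionB2b (p := (5 : ℝ)) (q := (7 : ℝ)) (cθ := ((58687283 : ℝ) / 26250000)) (by norm_num) hy.1 hy.2 (by norm_num)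
    (fun y hpy ↦ by have := neg_thetaL_ge_of_one_le (p := (5 : ℝ)) (by norm_num) hpy; norm_num at this ⊢; linarith) 4 (by norm_num [eL])
  norm_num [tOne, gL, kL, dL, eL, logLB] at h ⊢
  linarith

/-- Piece `[7, 9]`. [cite: AriasDeReyna2011, proof of Thm. 4.2] -/
theorem pieceB2_10 : PieceOK (7 : ℝ) (9 : ℝ) ((112864908698847071 : ℝ) / 9306035900000000) ((13 : ℝ) / 4) := by
  refine ⟨by norm_num, ?_, by norm_num, by norm_num, by norm_num [eL], by norm_num [eL]⟩
  intro y hy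
  have h := wL_ge_regionB2b (p := (7 : ℝ)) (q := (9 : ℝ)) (cθ := ((3259994487899 : ℝ) / 1441200250000)) (by norm_num) hy.1 hy.2 (by norm_num)
    (fun y hpy ↦ by have := neg_thetaL_ge_of_one_le (p := (7 : ℝ)) (by norm_num) hpy; norm_num at this ⊢; linarith) 5 (by norm_num [eL])
  norm_num [tOne, gL, kL, dL, eL, logLB] at h ⊢
  linarith

/-- Piece `[9, 10]`. [cite: AriasDeReyna2011, proof of Thm. 4.2] -/
theorem pieceB2_11 : PieceOK (9 : ℝ) (10 : ℝ) ((36610722107429887 : ℝ) / 1860043500000000) ((17 : ℝ) / 4) := by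
  refine ⟨by norm_num, ?_, by norm_num, by norm_num, by norm_num [eL], by norm_num [eL]⟩
  intro y hy
  have h := wL_ge_regionB2b (p := (9 : ℝ)) (q := (10 : ℝ)) (cθ := ((19033176803317 : ℝ) / 8370195750000)) (by norm_num) hy.1 hy.2 (by norm_num)
    (fun y hpy ↦ by have := neg_thetaL_ge_of_one_le (p := (9 : ℝ)) (by norm_num) hpy; norm_num at this ⊢; linarith) 5 (by norm_num [eL])
  norm_num [tOne, gL, kL, dL, eL, logLB] at h ⊢
  linarith

/-! ## The tails `|y| ≥ 10` -/

/-- `∫_{y ≥ 10} dy/W ≤ 0.45` (`W ≥ y²/4.5` there). [cite: AriasDeReyna2011, proof of Thm. 4.2] -/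
theorem integral_inv_wL_Ioi_le (hWi : Integrable fun y : ℝ ↦ (wL y)⁻¹) :
    ∫ y in Ioi (10 : ℝ), (wL y)⁻¹ ≤ 0.45 := by
  have hmaj : IntegrableOn (fun y : ℝ ↦ (4.5 : ℝ) * y ^ (-2 : ℝ)) (Ioi 10) :=
    (integrableOn_Ioi_rpow_of_lt (by norm_num) (by norm_num)).const_mul _
  have hval : ∫ y in Ioi (10 : ℝ), (4.5 : ℝ) * y ^ (-2 : ℝ) = 0.45 := by
    rw [integral_const_mul, integral_Ioi_rpow_of_lt (by norm_num) (by norm_num)]; norm_num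
  rw [← hval]
  refine setIntegral_mono_on hWi.integrableOn hmaj measurableSet_Ioi fun y hy ↦ ?_
  have hy10 : 10 < y := hy
  have hW := wL_ge_tail_right hy10.le
  have hy0 : 0 < y := by linarith
  have hWpos : 0 < wL y := lt_of_lt_of_le (by positivity) hW
  rw [Real.rpow_neg hy0.le, Real.rpow_two, inv_le_iff_one_le_mul₀ hWpos]
  have : y ^ 2 / 4.5 * (4.5 * (y ^ 2)⁻¹) = 1 := by field_simp
  nlinarith [mul_le_mul_of_nonneg_right hW (by positivity : (0:ℝ) ≤ 4.5 * (y ^ 2)⁻¹)]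

/-- `∫_{y ≤ −10} dy/W ≤ 0.4` (`W ≥ y²/4` there). [cite: AriasDeReyna2011, proof of Thm. 4.2] -/
theorem integral_inv_wL_Iic_le (hWi : Integrable fun y : ℝ ↦ (wL y)⁻¹) :
    ∫ y in Iic (-10 : ℝ), (wL y)⁻¹ ≤ 0.4 := by
  have hmaj : IntegrableOn (fun y : ℝ ↦ (4 : ℝ) * y ^ (-2 : ℝ)) (Ioi 10) :=
    (integrableOn_Ioi_rpow_of_lt (by norm_num) (by norm_num)).const_mul _
  have hval : ∫ y in Ioi (10 : ℝ), (4 : ℝ) * y ^ (-2 : ℝ) = 0.4 := by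
    rw [integral_const_mul, integral_Ioi_rpow_of_lt (by norm_num) (by norm_num)]; norm_num
  have hneg : ∫ y in Iic (-10 : ℝ), (wL y)⁻¹ = ∫ y in Ioi (10 : ℝ), (wL (-y))⁻¹ := by
    rw [integral_comp_neg_Ioi (c := 10) (f := fun y : ℝ ↦ (wL y)⁻¹)]
  rw [hneg, ← hval]
  refine setIntegral_mono_on (hWi.comp_neg.integrableOn) hmaj measurableSet_Ioi fun y hy ↦ ?_
  have hy10 : 10 < y := hy
  have hW := wL_ge_tail_left (y := -y) (by linarith)
  have hy0 : 0 < y := by linarith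
  rw [neg_sq] at hW
  have hWpos : 0 < wL (-y) := lt_of_lt_of_le (by positivity) hW
  rw [Real.rpow_neg hy0.le, Real.rpow_two, inv_le_iff_one_le_mul₀ hWpos]
  have : y ^ 2 / 4 * (4 * (y ^ 2)⁻¹) = 1 := by field_simp
  nlinarith [mul_le_mul_of_nonneg_right hW (by positivity : (0:ℝ) ≤ 4 * (y ^ 2)⁻¹)]

/-! ## Assembly: the three constants -/

/-- Gluing two adjacent pieces. [folklore] -/
private lemma cover_step {a b c : ℝ} {P : ℝ → Prop} (h1 : ∀ y ∈ Icc a b, P y) (h2 : ∀ y ∈ Icc b c, P y) :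
    ∀ y ∈ Icc a c, P y := by
  intro y hy
  rcases le_or_gt y b with h | h
  · exact h1 y ⟨hy.1, h⟩
  · exact h2 y ⟨h.le, hy.2⟩

/-- On `[−10, 10]`: `W ≥ 0.1316` and `|1 − ζ|² ≤ 6.15 W`, from the 40 pieces. [cite: AriasDeReyna2011, proof of Thm. 4.2] -/
theorem pointwise_middle :
    ∀ y ∈ Icc (-10 : ℝ) 10, (0.1316 : ℝ) ≤ wL y ∧ ‖1 - lineL y‖ ^ 2 ≤ 6.15 * wL y := by

  have c0 : ∀ y ∈ Icc ((-10 : ℝ)) ((-8 : ℝ)), (0.1316 : ℝ) ≤ wL y ∧ ‖1 - lineL y‖ ^ 2 ≤ 6.15 * wL y :=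
    pieceA_0.pointwise
  have c1 : ∀ y ∈ Icc ((-10 : ℝ)) ((-6 : ℝ)), (0.1316 : ℝ) ≤ wL y ∧ ‖1 - lineL y‖ ^ 2 ≤ 6.15 * wL y :=
    cover_step c0 pieceA_1.pointwise
  have c2 : ∀ y ∈ Icc ((-10 : ℝ)) ((-5 : ℝ)), (0.1316 : ℝ) ≤ wL y ∧ ‖1 - lineL y‖ ^ 2 ≤ 6.15 * wL y :=
    cover_step c1 pieceA_2.pointwise
  have c3 : ∀ y ∈ Icc ((-10 : ℝ)) ((-4 : ℝ)), (0.1316 : ℝ) ≤ wL y ∧ ‖1 - lineL y‖ ^ 2 ≤ 6.15 * wL y :=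
    cover_step c2 pieceA_3.pointwise
  have c4 : ∀ y ∈ Icc ((-10 : ℝ)) ((-3 : ℝ)), (0.1316 : ℝ) ≤ wL y ∧ ‖1 - lineL y‖ ^ 2 ≤ 6.15 * wL y :=
    cover_step c3 pieceA_4.pointwise
  have c5 : ∀ y ∈ Icc ((-10 : ℝ)) (((-5 : ℝ) / 2)), (0.1316 : ℝ) ≤ wL y ∧ ‖1 - lineL y‖ ^ 2 ≤ 6.15 * wL y :=
    cover_step c4 pieceA_5.pointwise
  have c6 : ∀ y ∈ Icc ((-10 : ℝ)) (((-9 : ℝ) / 4)), (0.1316 : ℝ) ≤ wL y ∧ ‖1 - lineL y‖ ^ 2 ≤ 6.15 * wL y :=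
    cover_step c5 pieceA_6.pointwise
  have c7 : ∀ y ∈ Icc ((-10 : ℝ)) ((-2 : ℝ)), (0.1316 : ℝ) ≤ wL y ∧ ‖1 - lineL y‖ ^ 2 ≤ 6.15 * wL y :=
    cover_step c6 pieceA_7.pointwise
  have c8 : ∀ y ∈ Icc ((-10 : ℝ)) (((-7 : ℝ) / 4)), (0.1316 : ℝ) ≤ wL y ∧ ‖1 - lineL y‖ ^ 2 ≤ 6.15 * wL y :=
    cover_step c7 pieceA_8.pointwise
  have c9 : ∀ y ∈ Icc ((-10 : ℝ)) (((-13 : ℝ) / 8)), (0.1316 : ℝ) ≤ wL y ∧ ‖1 - lineL y‖ ^ 2 ≤ 6.15 * wL y :=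
    cover_step c8 pieceA_9.pointwise
  have c10 : ∀ y ∈ Icc ((-10 : ℝ)) (((-3 : ℝ) / 2)), (0.1316 : ℝ) ≤ wL y ∧ ‖1 - lineL y‖ ^ 2 ≤ 6.15 * wL y :=
    cover_step c9 pieceA_10.pointwise
  have c11 : ∀ y ∈ Icc ((-10 : ℝ)) (((-11 : ℝ) / 8)), (0.1316 : ℝ) ≤ wL y ∧ ‖1 - lineL y‖ ^ 2 ≤ 6.15 * wL y :=
    cover_step c10 pieceA_11.pointwise
  have c12 : ∀ y ∈ Icc ((-10 : ℝ)) (((-5 : ℝ) / 4)), (0.1316 : ℝ) ≤ wL y ∧ ‖1 - lineL y‖ ^ 2 ≤ 6.15 * wL y :=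
    cover_step c11 pieceA_12.pointwise
  have c13 : ∀ y ∈ Icc ((-10 : ℝ)) (((-11 : ℝ) / 10)), (0.1316 : ℝ) ≤ wL y ∧ ‖1 - lineL y‖ ^ 2 ≤ 6.15 * wL y :=
    cover_step c12 e1Piece_0.pointwise
  have c14 : ∀ y ∈ Icc ((-10 : ℝ)) (((-19 : ℝ) / 20)), (0.1316 : ℝ) ≤ wL y ∧ ‖1 - lineL y‖ ^ 2 ≤ 6.15 * wL y :=
    cover_step c13 e1Piece_1.pointwise
  have c15 : ∀ y ∈ Icc ((-10 : ℝ)) (((-4 : ℝ) / 5)), (0.1316 : ℝ) ≤ wL y ∧ ‖1 - lineL y‖ ^ 2 ≤ 6.15 * wL y :=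
    cover_step c14 e1Piece_2.pointwise
  have c16 : ∀ y ∈ Icc ((-10 : ℝ)) (((-27 : ℝ) / 40)), (0.1316 : ℝ) ≤ wL y ∧ ‖1 - lineL y‖ ^ 2 ≤ 6.15 * wL y :=
    cover_step c15 e1Piece_3.pointwise
  have c17 : ∀ y ∈ Icc ((-10 : ℝ)) (((-3 : ℝ) / 5)), (0.1316 : ℝ) ≤ wL y ∧ ‖1 - lineL y‖ ^ 2 ≤ 6.15 * wL y :=
    cover_step c16 e1Piece_4.pointwise
  have c18 : ∀ y ∈ Icc ((-10 : ℝ)) (((-11 : ℝ) / 20)), (0.1316 : ℝ) ≤ wL y ∧ ‖1 - lineL y‖ ^ 2 ≤ 6.15 * wL y :=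
    cover_step c17 e1Piece_5.pointwise
  have c19 : ∀ y ∈ Icc ((-10 : ℝ)) (((-9 : ℝ) / 20)), (0.1316 : ℝ) ≤ wL y ∧ ‖1 - lineL y‖ ^ 2 ≤ 6.15 * wL y :=
    cover_step c18 e1Piece_6.pointwise
  have c20 : ∀ y ∈ Icc ((-10 : ℝ)) (((-3 : ℝ) / 10)), (0.1316 : ℝ) ≤ wL y ∧ ‖1 - lineL y‖ ^ 2 ≤ 6.15 * wL y :=
    cover_step c19 e1Piece_7.pointwise
  have c21 : ∀ y ∈ Icc ((-10 : ℝ)) (((-3 : ℝ) / 20)), (0.1316 : ℝ) ≤ wL y ∧ ‖1 - lineL y‖ ^ 2 ≤ 6.15 * wL y :=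
    cover_step c20 e1Piece_8.pointwise
  have c22 : ∀ y ∈ Icc ((-10 : ℝ)) ((0 : ℝ)), (0.1316 : ℝ) ≤ wL y ∧ ‖1 - lineL y‖ ^ 2 ≤ 6.15 * wL y :=
    cover_step c21 e1Piece_9.pointwise
  have c23 : ∀ y ∈ Icc ((-10 : ℝ)) (((3 : ℝ) / 20)), (0.1316 : ℝ) ≤ wL y ∧ ‖1 - lineL y‖ ^ 2 ≤ 6.15 * wL y :=
    cover_step c22 e1Piece_10.pointwise
  have c24 : ∀ y ∈ Icc ((-10 : ℝ)) (((3 : ℝ) / 10)), (0.1316 : ℝ) ≤ wL y ∧ ‖1 - lineL y‖ ^ 2 ≤ 6.15 * wL y :=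
    cover_step c23 e1Piece_11.pointwise
  have c25 : ∀ y ∈ Icc ((-10 : ℝ)) (((7 : ℝ) / 20)), (0.1316 : ℝ) ≤ wL y ∧ ‖1 - lineL y‖ ^ 2 ≤ 6.15 * wL y :=
    cover_step c24 pieceB1_0.pointwise
  have c26 : ∀ y ∈ Icc ((-10 : ℝ)) (((9 : ℝ) / 20)), (0.1316 : ℝ) ≤ wL y ∧ ‖1 - lineL y‖ ^ 2 ≤ 6.15 * wL y :=
    cover_step c25 pieceB1_1.pointwise
  have c27 : ∀ y ∈ Icc ((-10 : ℝ)) (((1 : ℝ) / 2)), (0.1316 : ℝ) ≤ wL y ∧ ‖1 - lineL y‖ ^ 2 ≤ 6.15 * wL y :=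
    cover_step c26 pieceB1_2.pointwise
  have c28 : ∀ y ∈ Icc ((-10 : ℝ)) (((5 : ℝ) / 8)), (0.1316 : ℝ) ≤ wL y ∧ ‖1 - lineL y‖ ^ 2 ≤ 6.15 * wL y :=
    cover_step c27 pieceB2_0.pointwise
  have c29 : ∀ y ∈ Icc ((-10 : ℝ)) (((3 : ℝ) / 4)), (0.1316 : ℝ) ≤ wL y ∧ ‖1 - lineL y‖ ^ 2 ≤ 6.15 * wL y :=
    cover_step c28 pieceB2_1.pointwise
  have c30 : ∀ y ∈ Icc ((-10 : ℝ)) (((7 : ℝ) / 8)), (0.1316 : ℝ) ≤ wL y ∧ ‖1 - lineL y‖ ^ 2 ≤ 6.15 * wL y :=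
    cover_step c29 pieceB2_2.pointwise
  have c31 : ∀ y ∈ Icc ((-10 : ℝ)) ((1 : ℝ)), (0.1316 : ℝ) ≤ wL y ∧ ‖1 - lineL y‖ ^ 2 ≤ 6.15 * wL y :=
    cover_step c30 pieceB2_3.pointwise
  have c32 : ∀ y ∈ Icc ((-10 : ℝ)) (((5 : ℝ) / 4)), (0.1316 : ℝ) ≤ wL y ∧ ‖1 - lineL y‖ ^ 2 ≤ 6.15 * wL y :=
    cover_step c31 pieceB2_4.pointwise
  have c33 : ∀ y ∈ Icc ((-10 : ℝ)) (((3 : ℝ) / 2)), (0.1316 : ℝ) ≤ wL y ∧ ‖1 - lineL y‖ ^ 2 ≤ 6.15 * wL y :=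
    cover_step c32 pieceB2_5.pointwise
  have c34 : ∀ y ∈ Icc ((-10 : ℝ)) ((2 : ℝ)), (0.1316 : ℝ) ≤ wL y ∧ ‖1 - lineL y‖ ^ 2 ≤ 6.15 * wL y :=
    cover_step c33 pieceB2_6.pointwise
  have c35 : ∀ y ∈ Icc ((-10 : ℝ)) ((3 : ℝ)), (0.1316 : ℝ) ≤ wL y ∧ ‖1 - lineL y‖ ^ 2 ≤ 6.15 * wL y :=
    cover_step c34 pieceB2_7.pointwise
  have c36 : ∀ y ∈ Icc ((-10 : ℝ)) ((5 : ℝ)), (0.1316 : ℝ) ≤ wL y ∧ ‖1 - lineL y‖ ^ 2 ≤ 6.15 * wL y :=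
    cover_step c35 pieceB2_8.pointwise
  have c37 : ∀ y ∈ Icc ((-10 : ℝ)) ((7 : ℝ)), (0.1316 : ℝ) ≤ wL y ∧ ‖1 - lineL y‖ ^ 2 ≤ 6.15 * wL y :=
    cover_step c36 pieceB2_9.pointwise
  have c38 : ∀ y ∈ Icc ((-10 : ℝ)) ((9 : ℝ)), (0.1316 : ℝ) ≤ wL y ∧ ‖1 - lineL y‖ ^ 2 ≤ 6.15 * wL y :=
    cover_step c37 pieceB2_10.pointwise
  have c39 : ∀ y ∈ Icc ((-10 : ℝ)) ((10 : ℝ)), (0.1316 : ℝ) ≤ wL y ∧ ‖1 - lineL y‖ ^ 2 ≤ 6.15 * wL y :=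
    cover_step c38 pieceB2_11.pointwise
  exact c39

/-- **`min_L W ≥ 0.1316`** and **`|1 − ζ|² ≤ 6.15 W` on `L`**. [cite: AriasDeReyna2011, proof of Thm. 4.2 ("`max 1/((1+V)|ζ|²) ≈ 7.489341`", "`|1−ζ|²/(|ζ|²(1+V)) ≤ 5.78453`")] -/
theorem wL_ge_min_and_normSq_le (y : ℝ) : (0.1316 : ℝ) ≤ wL y ∧ ‖1 - lineL y‖ ^ 2 ≤ 6.15 * wL y := by
  rcases le_or_gt y (-10) with h | h
  · have hW := wL_ge_tail_left h
    rw [normSq_one_sub_lineL_eq_eL]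
    constructor
    · nlinarith
    · unfold eL; nlinarith
  rcases le_or_gt y 10 with h' | h'
  · exact pointwise_middle y ⟨h.le, h'⟩
  · have hW := wL_ge_tail_right h'.le
    rw [normSq_one_sub_lineL_eq_eL]
    norm_num at hW
    constructor
    · nlinarith
    · unfold eL; nlinarith

/-- **The first constant**: `W(y) ≥ 0.1316` on all of `L`. [cite: AriasDeReyna2011, proof of Thm. 4.2] -/
theorem wL_ge_min (y : ℝ) : (0.1316 : ℝ) ≤ wL y := (wL_ge_min_and_normSq_le y).1

/-- **The third constant**: `|1 − ζ(y)|² ≤ 6.15 W(y)` on all of `L`. [cite: AriasDeReyna2011, proof of Thm. 4.2] -/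
theorem normSq_one_sub_lineL_le (y : ℝ) : ‖1 - lineL y‖ ^ 2 ≤ 6.15 * wL y := (wL_ge_min_and_normSq_le y).2

/-- `1/W` is integrable over `ℝ` (continuous, positive, `≤ 4.5/y²` for `|y| ≥ 10`). [cite: AriasDeReyna2011, proof of Thm. 4.2] -/
theorem integrable_inv_wL : Integrable fun y : ℝ ↦ (wL y)⁻¹ := by
  have hpos : ∀ y, 0 < wL y := fun y ↦ lt_of_lt_of_le (by norm_num) (wL_ge_min y)
  have hcont : Continuous fun y : ℝ ↦ (((wL y)⁻¹ : ℝ) : ℂ) :=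
    continuous_ofReal.comp (continuous_wL.inv₀ fun y ↦ (hpos y).ne')
  have h := Literature.Analysis.Complex.integrable_of_continuous_of_decay_sq (C := 4.5) (R := 10) hcont
    fun y hy ↦ by
      rw [Complex.norm_real, Real.norm_eq_abs, abs_of_pos (inv_pos.2 (hpos y))]
      have hyne : y ≠ 0 := by
        intro h0; rw [h0, abs_zero] at hy; norm_num at hy
      have hy2 : 0 < y ^ 2 := by positivity
      have hW : y ^ 2 / 4.5 ≤ wL y := by
        rcases le_or_gt 0 y with h0 | h0
        · rw [abs_of_nonneg h0] at hy; exact wL_ge_tail_right hy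
        · rw [abs_of_neg h0] at hy
          have := wL_ge_tail_left (y := y) (by linarith)
          have h45 : y ^ 2 / 4.5 ≤ y ^ 2 / 4 := by
            rw [show (4.5 : ℝ) = 9 / 2 by norm_num]; linarith [sq_nonneg y]
          linarith
      rw [inv_le_comm₀ (hpos y) (by positivity)]
      calc (4.5 / y ^ 2)⁻¹ = y ^ 2 / 4.5 := by rw [inv_div]
        _ ≤ wL y := hW
  exact h.re.congr (Eventually.of_forall fun y ↦ by simp)


/-! ## The second constant: `∫ dy/W ≤ 15` -/

/-- **`∫_ℝ dy/W ≤ 15`**: the 40 trapezoid bounds (total `13.67`) plus the tails (`0.4 + 0.45`).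
[cite: AriasDeReyna2011, proof of Thm. 4.2 ("`∫_L |dζ|/((1+V)|ζ|²) ≈ 9.577048`")] -/
theorem integral_inv_wL_le : ∫ y : ℝ, (wL y)⁻¹ ≤ 15 := by
  have hWi := integrable_inv_wL
  have hii : ∀ a b : ℝ, IntervalIntegrable (fun y : ℝ ↦ (wL y)⁻¹) volume a b := fun a b ↦ hWi.intervalIntegrable
  have b0 : ∫ y in ((-10 : ℝ))..((-8 : ℝ)), (wL y)⁻¹ ≤ ((9787 : ℝ) / 100000) := (pieceA_0.integral_le hWi).trans (by norm_num)
  have b1 : ∫ y in ((-8 : ℝ))..((-6 : ℝ)), (wL y)⁻¹ ≤ ((8337 : ℝ) / 50000) := (pieceA_1.integral_le hWi).trans (by norm_num)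
  have b2 : ∫ y in ((-6 : ℝ))..((-5 : ℝ)), (wL y)⁻¹ ≤ ((257 : ℝ) / 2000) := (pieceA_2.integral_le hWi).trans (by norm_num)
  have b3 : ∫ y in ((-5 : ℝ))..((-4 : ℝ)), (wL y)⁻¹ ≤ ((79 : ℝ) / 400) := (pieceA_3.integral_le hWi).trans (by norm_num)
  have b4 : ∫ y in ((-4 : ℝ))..((-3 : ℝ)), (wL y)⁻¹ ≤ ((35191 : ℝ) / 100000) := (pieceA_4.integral_le hWi).trans (by norm_num)
  have b5 : ∫ y in ((-3 : ℝ))..(((-5 : ℝ) / 2)), (wL y)⁻¹ ≤ ((27767 : ℝ) / 100000) := (pieceA_5.integral_le hWi).trans (by norm_num)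
  have b6 : ∫ y in (((-5 : ℝ) / 2))..(((-9 : ℝ) / 4)), (wL y)⁻¹ ≤ ((9137 : ℝ) / 50000) := (pieceA_6.integral_le hWi).trans (by norm_num)
  have b7 : ∫ y in (((-9 : ℝ) / 4))..((-2 : ℝ)), (wL y)⁻¹ ≤ ((23837 : ℝ) / 100000) := (pieceA_7.integral_le hWi).trans (by norm_num)
  have b8 : ∫ y in ((-2 : ℝ))..(((-7 : ℝ) / 4)), (wL y)⁻¹ ≤ ((821 : ℝ) / 2500) := (pieceA_8.integral_le hWi).trans (by norm_num)
  have b9 : ∫ y in (((-7 : ℝ) / 4))..(((-13 : ℝ) / 8)), (wL y)⁻¹ ≤ ((3927 : ℝ) / 20000) := (pieceA_9.integral_le hWi).trans (by norm_num)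
  have b10 : ∫ y in (((-13 : ℝ) / 8))..(((-3 : ℝ) / 2)), (wL y)⁻¹ ≤ ((5971 : ℝ) / 25000) := (pieceA_10.integral_le hWi).trans (by norm_num)
  have b11 : ∫ y in (((-3 : ℝ) / 2))..(((-11 : ℝ) / 8)), (wL y)⁻¹ ≤ ((1867 : ℝ) / 6250) := (pieceA_11.integral_le hWi).trans (by norm_num)
  have b12 : ∫ y in (((-11 : ℝ) / 8))..(((-5 : ℝ) / 4)), (wL y)⁻¹ ≤ ((4833 : ℝ) / 12500) := (pieceA_12.integral_le hWi).trans (by norm_num)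
  have b13 : ∫ y in (((-5 : ℝ) / 4))..(((-11 : ℝ) / 10)), (wL y)⁻¹ ≤ ((23921 : ℝ) / 50000) := (e1Piece_0.integral_le hWi).trans (by norm_num)
  have b14 : ∫ y in (((-11 : ℝ) / 10))..(((-19 : ℝ) / 20)), (wL y)⁻¹ ≤ ((1567 : ℝ) / 2500) := (e1Piece_1.integral_le hWi).trans (by norm_num)
  have b15 : ∫ y in (((-19 : ℝ) / 20))..(((-4 : ℝ) / 5)), (wL y)⁻¹ ≤ ((81911 : ℝ) / 100000) := (e1Piece_2.integral_le hWi).trans (by norm_num)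
  have b16 : ∫ y in (((-4 : ℝ) / 5))..(((-27 : ℝ) / 40)), (wL y)⁻¹ ≤ ((83067 : ℝ) / 100000) := (e1Piece_3.integral_le hWi).trans (by norm_num)
  have b17 : ∫ y in (((-27 : ℝ) / 40))..(((-3 : ℝ) / 5)), (wL y)⁻¹ ≤ ((54439 : ℝ) / 100000) := (e1Piece_4.integral_le hWi).trans (by norm_num)
  have b18 : ∫ y in (((-3 : ℝ) / 5))..(((-11 : ℝ) / 20)), (wL y)⁻¹ ≤ ((37379 : ℝ) / 100000) := (e1Piece_5.integral_le hWi).trans (by norm_num)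
  have b19 : ∫ y in (((-11 : ℝ) / 20))..(((-9 : ℝ) / 20)), (wL y)⁻¹ ≤ ((471 : ℝ) / 625) := (e1Piece_6.integral_le hWi).trans (by norm_num)
  have b20 : ∫ y in (((-9 : ℝ) / 20))..(((-3 : ℝ) / 10)), (wL y)⁻¹ ≤ ((20781 : ℝ) / 20000) := (e1Piece_7.integral_le hWi).trans (by norm_num)
  have b21 : ∫ y in (((-3 : ℝ) / 10))..(((-3 : ℝ) / 20)), (wL y)⁻¹ ≤ ((2031 : ℝ) / 2500) := (e1Piece_8.integral_le hWi).trans (by norm_num)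
  have b22 : ∫ y in (((-3 : ℝ) / 20))..((0 : ℝ)), (wL y)⁻¹ ≤ ((14617 : ℝ) / 25000) := (e1Piece_9.integral_le hWi).trans (by norm_num)
  have b23 : ∫ y in ((0 : ℝ))..(((3 : ℝ) / 20)), (wL y)⁻¹ ≤ ((20523 : ℝ) / 50000) := (e1Piece_10.integral_le hWi).trans (by norm_num)
  have b24 : ∫ y in (((3 : ℝ) / 20))..(((3 : ℝ) / 10)), (wL y)⁻¹ ≤ ((29259 : ℝ) / 100000) := (e1Piece_11.integral_le hWi).trans (by norm_num)
  have b25 : ∫ y in (((3 : ℝ) / 10))..(((7 : ℝ) / 20)), (wL y)⁻¹ ≤ ((423 : ℝ) / 5000) := (pieceB1_0.integral_le hWi).trans (by norm_num)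
  have b26 : ∫ y in (((7 : ℝ) / 20))..(((9 : ℝ) / 20)), (wL y)⁻¹ ≤ ((1999 : ℝ) / 12500) := (pieceB1_1.integral_le hWi).trans (by norm_num)
  have b27 : ∫ y in (((9 : ℝ) / 20))..(((1 : ℝ) / 2)), (wL y)⁻¹ ≤ ((1621 : ℝ) / 25000) := (pieceB1_2.integral_le hWi).trans (by norm_num)
  have b28 : ∫ y in (((1 : ℝ) / 2))..(((5 : ℝ) / 8)), (wL y)⁻¹ ≤ ((7987 : ℝ) / 50000) := (pieceB2_0.integral_le hWi).trans (by norm_num)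
  have b29 : ∫ y in (((5 : ℝ) / 8))..(((3 : ℝ) / 4)), (wL y)⁻¹ ≤ ((1391 : ℝ) / 10000) := (pieceB2_1.integral_le hWi).trans (by norm_num)
  have b30 : ∫ y in (((3 : ℝ) / 4))..(((7 : ℝ) / 8)), (wL y)⁻¹ ≤ ((6159 : ℝ) / 50000) := (pieceB2_2.integral_le hWi).trans (by norm_num)
  have b31 : ∫ y in (((7 : ℝ) / 8))..((1 : ℝ)), (wL y)⁻¹ ≤ ((5579 : ℝ) / 50000) := (pieceB2_3.integral_le hWi).trans (by norm_num)
  have b32 : ∫ y in ((1 : ℝ))..(((5 : ℝ) / 4)), (wL y)⁻¹ ≤ ((1087 : ℝ) / 5000) := (pieceB2_4.integral_le hWi).trans (by norm_num)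
  have b33 : ∫ y in (((5 : ℝ) / 4))..(((3 : ℝ) / 2)), (wL y)⁻¹ ≤ ((919 : ℝ) / 5000) := (pieceB2_5.integral_le hWi).trans (by norm_num)
  have b34 : ∫ y in (((3 : ℝ) / 2))..((2 : ℝ)), (wL y)⁻¹ ≤ ((13 : ℝ) / 40) := (pieceB2_6.integral_le hWi).trans (by norm_num)
  have b35 : ∫ y in ((2 : ℝ))..((3 : ℝ)), (wL y)⁻¹ ≤ ((48589 : ℝ) / 100000) := (pieceB2_7.integral_le hWi).trans (by norm_num)
  have b36 : ∫ y in ((3 : ℝ))..((5 : ℝ)), (wL y)⁻¹ ≤ ((10709 : ℝ) / 20000) := (pieceB2_8.integral_le hWi).trans (by norm_num)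
  have b37 : ∫ y in ((5 : ℝ))..((7 : ℝ)), (wL y)⁻¹ ≤ ((4867 : ℝ) / 20000) := (pieceB2_9.integral_le hWi).trans (by norm_num)
  have b38 : ∫ y in ((7 : ℝ))..((9 : ℝ)), (wL y)⁻¹ ≤ ((6807 : ℝ) / 50000) := (pieceB2_10.integral_le hWi).trans (by norm_num)
  have b39 : ∫ y in ((9 : ℝ))..((10 : ℝ)), (wL y)⁻¹ ≤ ((463 : ℝ) / 10000) := (pieceB2_11.integral_le hWi).trans (by norm_num)
  have s0 := intervalIntegral.integral_add_adjacent_intervals (hii ((-10 : ℝ)) ((-8 : ℝ))) (hii ((-8 : ℝ)) ((-6 : ℝ)))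
  have s1 := intervalIntegral.integral_add_adjacent_intervals (hii ((-10 : ℝ)) ((-6 : ℝ))) (hii ((-6 : ℝ)) ((-5 : ℝ)))
  have s2 := intervalIntegral.integral_add_adjacent_intervals (hii ((-10 : ℝ)) ((-5 : ℝ))) (hii ((-5 : ℝ)) ((-4 : ℝ)))
  have s3 := intervalIntegral.integral_add_adjacent_intervals (hii ((-10 : ℝ)) ((-4 : ℝ))) (hii ((-4 : ℝ)) ((-3 : ℝ)))
  have s4 := intervalIntegral.integral_add_adjacent_intervals (hii ((-10 : ℝ)) ((-3 : ℝ))) (hii ((-3 : ℝ)) (((-5 : ℝ) / 2)))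
  have s5 := intervalIntegral.integral_add_adjacent_intervals (hii ((-10 : ℝ)) (((-5 : ℝ) / 2))) (hii (((-5 : ℝ) / 2)) (((-9 : ℝ) / 4)))
  have s6 := intervalIntegral.integral_add_adjacent_intervals (hii ((-10 : ℝ)) (((-9 : ℝ) / 4))) (hii (((-9 : ℝ) / 4)) ((-2 : ℝ)))
  have s7 := intervalIntegral.integral_add_adjacent_intervals (hii ((-10 : ℝ)) ((-2 : ℝ))) (hii ((-2 : ℝ)) (((-7 : ℝ) / 4)))
  have s8 := intervalIntegral.integral_add_adjacent_intervals (hii ((-10 : ℝ)) (((-7 : ℝ) / 4))) (hii (((-7 : ℝ) / 4)) (((-13 : ℝ) / 8)))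
  have s9 := intervalIntegral.integral_add_adjacent_intervals (hii ((-10 : ℝ)) (((-13 : ℝ) / 8))) (hii (((-13 : ℝ) / 8)) (((-3 : ℝ) / 2)))
  have s10 := intervalIntegral.integral_add_adjacent_intervals (hii ((-10 : ℝ)) (((-3 : ℝ) / 2))) (hii (((-3 : ℝ) / 2)) (((-11 : ℝ) / 8)))
  have s11 := intervalIntegral.integral_add_adjacent_intervals (hii ((-10 : ℝ)) (((-11 : ℝ) / 8))) (hii (((-11 : ℝ) / 8)) (((-5 : ℝ) / 4)))
  have s12 := intervalIntegral.integral_add_adjacent_intervals (hii ((-10 : ℝ)) (((-5 : ℝ) / 4))) (hii (((-5 : ℝ) / 4)) (((-11 : ℝ) / 10)))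
  have s13 := intervalIntegral.integral_add_adjacent_intervals (hii ((-10 : ℝ)) (((-11 : ℝ) / 10))) (hii (((-11 : ℝ) / 10)) (((-19 : ℝ) / 20)))
  have s14 := intervalIntegral.integral_add_adjacent_intervals (hii ((-10 : ℝ)) (((-19 : ℝ) / 20))) (hii (((-19 : ℝ) / 20)) (((-4 : ℝ) / 5)))
  have s15 := intervalIntegral.integral_add_adjacent_intervals (hii ((-10 : ℝ)) (((-4 : ℝ) / 5))) (hii (((-4 : ℝ) / 5)) (((-27 : ℝ) / 40)))
  have s16 := intervalIntegral.integral_add_adjacent_intervals (hii ((-10 : ℝ)) (((-27 : ℝ) / 40))) (hii (((-27 : ℝ) / 40)) (((-3 : ℝ) / 5)))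
  have s17 := intervalIntegral.integral_add_adjacent_intervals (hii ((-10 : ℝ)) (((-3 : ℝ) / 5))) (hii (((-3 : ℝ) / 5)) (((-11 : ℝ) / 20)))
  have s18 := intervalIntegral.integral_add_adjacent_intervals (hii ((-10 : ℝ)) (((-11 : ℝ) / 20))) (hii (((-11 : ℝ) / 20)) (((-9 : ℝ) / 20)))
  have s19 := intervalIntegral.integral_add_adjacent_intervals (hii ((-10 : ℝ)) (((-9 : ℝ) / 20))) (hii (((-9 : ℝ) / 20)) (((-3 : ℝ) / 10)))
  have s20 := intervalIntegral.integral_add_adjacent_intervals (hii ((-10 : ℝ)) (((-3 : ℝ) / 10))) (hii (((-3 : ℝ) / 10)) (((-3 : ℝ) / 20)))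
  have s21 := intervalIntegral.integral_add_adjacent_intervals (hii ((-10 : ℝ)) (((-3 : ℝ) / 20))) (hii (((-3 : ℝ) / 20)) ((0 : ℝ)))
  have s22 := intervalIntegral.integral_add_adjacent_intervals (hii ((-10 : ℝ)) ((0 : ℝ))) (hii ((0 : ℝ)) (((3 : ℝ) / 20)))
  have s23 := intervalIntegral.integral_add_adjacent_intervals (hii ((-10 : ℝ)) (((3 : ℝ) / 20))) (hii (((3 : ℝ) / 20)) (((3 : ℝ) / 10)))
  have s24 := intervalIntegral.integral_add_adjacent_intervals (hii ((-10 : ℝ)) (((3 : ℝ) / 10))) (hii (((3 : ℝ) / 10)) (((7 : ℝ) / 20)))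
  have s25 := intervalIntegral.integral_add_adjacent_intervals (hii ((-10 : ℝ)) (((7 : ℝ) / 20))) (hii (((7 : ℝ) / 20)) (((9 : ℝ) / 20)))
  have s26 := intervalIntegral.integral_add_adjacent_intervals (hii ((-10 : ℝ)) (((9 : ℝ) / 20))) (hii (((9 : ℝ) / 20)) (((1 : ℝ) / 2)))
  have s27 := intervalIntegral.integral_add_adjacent_intervals (hii ((-10 : ℝ)) (((1 : ℝ) / 2))) (hii (((1 : ℝ) / 2)) (((5 : ℝ) / 8)))
  have s28 := intervalIntegral.integral_add_adjacent_intervals (hii ((-10 : ℝ)) (((5 : ℝ) / 8))) (hii (((5 : ℝ) / 8)) (((3 : ℝ) / 4)))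
  have s29 := intervalIntegral.integral_add_adjacent_intervals (hii ((-10 : ℝ)) (((3 : ℝ) / 4))) (hii (((3 : ℝ) / 4)) (((7 : ℝ) / 8)))
  have s30 := intervalIntegral.integral_add_adjacent_intervals (hii ((-10 : ℝ)) (((7 : ℝ) / 8))) (hii (((7 : ℝ) / 8)) ((1 : ℝ)))
  have s31 := intervalIntegral.integral_add_adjacent_intervals (hii ((-10 : ℝ)) ((1 : ℝ))) (hii ((1 : ℝ)) (((5 : ℝ) / 4)))
  have s32 := intervalIntegral.integral_add_adjacent_intervals (hii ((-10 : ℝ)) (((5 : ℝ) / 4))) (hii (((5 : ℝ) / 4)) (((3 : ℝ) / 2)))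
  have s33 := intervalIntegral.integral_add_adjacent_intervals (hii ((-10 : ℝ)) (((3 : ℝ) / 2))) (hii (((3 : ℝ) / 2)) ((2 : ℝ)))
  have s34 := intervalIntegral.integral_add_adjacent_intervals (hii ((-10 : ℝ)) ((2 : ℝ))) (hii ((2 : ℝ)) ((3 : ℝ)))
  have s35 := intervalIntegral.integral_add_adjacent_intervals (hii ((-10 : ℝ)) ((3 : ℝ))) (hii ((3 : ℝ)) ((5 : ℝ)))
  have s36 := intervalIntegral.integral_add_adjacent_intervals (hii ((-10 : ℝ)) ((5 : ℝ))) (hii ((5 : ℝ)) ((7 : ℝ)))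
  have s37 := intervalIntegral.integral_add_adjacent_intervals (hii ((-10 : ℝ)) ((7 : ℝ))) (hii ((7 : ℝ)) ((9 : ℝ)))
  have s38 := intervalIntegral.integral_add_adjacent_intervals (hii ((-10 : ℝ)) ((9 : ℝ))) (hii ((9 : ℝ)) ((10 : ℝ)))
  have htl := integral_inv_wL_Iic_le hWi
  have htr := integral_inv_wL_Ioi_le hWi
  have hsplit1 := intervalIntegral.integral_Iic_add_Ioi (f := fun y : ℝ ↦ (wL y)⁻¹) (b := 10) hWi.integrableOn hWi.integrableOn
  have hsplit2 := intervalIntegral.integral_Iic_sub_Iic (f := fun y : ℝ ↦ (wL y)⁻¹) (a := -10) (b := 10) hWi.integrableOn hWi.integrableOn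
  norm_num at *
  linarith

/-! ## Thm. 4.2, unconditionally -/

/-- **Arias de Reyna's Thm. 4.2** (bound for the remainder of Lehmer's form of the Riemann–Siegel expansion on the
saddle-point line): for `a > 0`, `σ` real, `K ≥ 1` with `σ ≥ 0` or `K + σ ≥ 2`,
`|c ∫ e^{−4πu²}(−w)^{K+1}ℛ_K du/(2i sin πx)| ≤ c₁(σ) Γ((K+1)/2) (1.1/a)^{K+1}`,
`c₁ = (1/7) 2^{3σ/2}` (`σ ≥ 0`), `c₁ = (1/2)(9/10)^{⌈−σ⌉}` (`σ < 0`). [cite: AriasDeReyna2011, Thm. 4.2, eqs. (4.7)–(4.8)] -/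
theorem norm_remainder_le {σ a : ℝ} {K : ℕ} (ha : 0 < a) (hK1 : 1 ≤ K) (hσK : 0 ≤ σ ∨ (2 : ℝ) ≤ K + σ) :
    ‖cConst * ∫ u, remIntegrand σ a K u‖ ≤
      (if 0 ≤ σ then 1 / 7 * (2 : ℝ) ^ (3 * σ / 2) else 1 / 2 * (9 / 10 : ℝ) ^ ⌈-σ⌉₊) *
        Real.Gamma (((K : ℝ) + 1) / 2) * (1.1 / a) ^ (K + 1) :=
  norm_cConst_mul_integral_remIntegrand_le ha hK1 hσK wL_ge_min integrable_inv_wL integral_inv_wL_le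
    normSq_one_sub_lineL_le

/-- **Thm. 3.1 with the bound of Thm. 4.2** for non-integer `a > 0`, `t = 2πa²`, `s = σ + it`, `N = ⌊a⌋`, `K ≥ 1`,
`σ ≥ 0` or `K + σ ≥ 2`:
`|∫_{N↙N+1} x^{−s}e^{πix²}/(e^{πix} − e^{−πix}) dx − (−1)^{N+1} U a^{−σ} Σ_{k≤K} C_k/a^k| ≤ a^{−σ} c₁(σ) Γ((K+1)/2)/(a/1.1)^{K+1}`.
[cite: AriasDeReyna2011, Thm. 3.1 (eq. (3.11)) and Thm. 4.2 (eqs. (4.7)–(4.8))] -/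
theorem norm_rsLineIntegral_sub_expansion_le {a : ℝ} (ha : 0 < a) (hai : ∀ n : ℤ, (n : ℝ) ≠ a) (σ : ℝ) {K : ℕ}
    (hK1 : 1 ≤ K) (hσK : 0 ≤ σ ∨ (2 : ℝ) ≤ K + σ) :
    ‖rsLineIntegral (⌊a⌋₊ + 1 / 2) ((σ : ℂ) + (2 * π * a ^ 2 : ℝ) * I) -
        (-1) ^ (⌊a⌋₊ + 1) * uPhase a * (a : ℂ) ^ (-(σ : ℂ)) *
          ∑ k ∈ Finset.range (K + 1), coef σ a k / (a : ℂ) ^ k‖ ≤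
      a ^ (-σ) * (if 0 ≤ σ then 1 / 7 * (2 : ℝ) ^ (3 * σ / 2) else 1 / 2 * (9 / 10 : ℝ) ^ ⌈-σ⌉₊) *
        Real.Gamma (((K : ℝ) + 1) / 2) / (a / 1.1) ^ (K + 1) :=
  norm_rsLineIntegral_sub_main_le ha hai σ hK1 hσK wL_ge_min integrable_inv_wL integral_inv_wL_le
    normSq_one_sub_lineL_le

end AriasDeReyna

end Literature.NumberTheory.LFunctions
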